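import Mathlib

/-!
# `TowerFourSubLiouville` (stmt-ABC-1649): Pell-boosted (torus) enemy families cannot force the saving below `1`

Negative-side structural lemma of the standing disprover (cycle 4, refuter-cdisprove-stmt-ABC-1649-g4-0),
companion of `Negative.PolynomialEnemyFloor` (p107305) and `Negative.UniformSavingCeiling` (p106450).

The open core of the crux is the uniform binomial quartic saving `UBQ η`
(`max(v,w) ≤ Z^η ⟹ |wZ⁴ − vY⁴| > Z^η` for coprime `vY, wZ`, `Z` large); an *enemy family* with
coefficients `≍ Z^θ` and values `≍ Z^φ` refutes `UBQ η` for every `η > max(θ, φ)`.  Known so far: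
`η ≤ 3/2` (explicit degree-2 identity, p106450); one-parameter POLYNOMIAL identities
`w(t)Z(t)⁴ − v(t)Y(t)⁴ = a(t)` obey `θ + φ ≥ 2 + 1/deg Z` (Mason–Stothers, p107305), so they never reach
`max(θ,φ) ≤ 1`, the probabilistic critical value.

Every *floor* family of this crux, on the other hand, is POLYNOMIAL–EXPONENTIAL: the Pell families of
`Negative.DialCalibration` / `Negative.LogLoss` evaluate Laurent polynomials at powers `εⁿ` of a real
quadratic unit.  Such "Pell-boosted" identities are identities `w Z⁴ − v Y⁴ = a` in the Laurent ring
`K[X, X⁻¹]` (the coordinate ring of the norm-one torus; a Galois-symmetric Laurent polynomial of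
half-width `m` evaluates at `X = εⁿ` to a rational integer of size `≍ ε^{nm}`), and clearing denominators
turns them into honest polynomial identities of the shape

  `W P⁴ − V Q⁴ = X^j · A`,   `deg P = 2·width(Z)`, `deg W = 2·width(w)`, `deg A = 2·width(a)`, `j ≥ 1`.

The extra factor `X^j` is exactly what the torus buys: the root `X = 0` is counted ONCE in the radical.
This file proves the corresponding floor (`masonStothers_torus_ineq`, `masonStothers_torus_floor`):

  `3·deg P ≤ deg V + deg Q + deg A`,  `3·deg Q ≤ deg W + deg P + deg A`,  hence
  `min (deg P) (deg Q) ≤ max (deg V, deg W, deg A)`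

(compare `3·deg Z + 1 ≤ …` and `deg Z + 1 ≤ max …` without the factor `X^j`).  In the `(θ, φ)` diagram:
P¹-identities live on or above the line `θ + φ = 2 + 1/z`, torus identities on or above `θ + φ = 2` —
which IS the probabilistic boundary.  So Pell-boosting could at best pin the ceiling of the core stub
`stub_genericFormsSaving` to the critical value `η = 1` (any `η > 1` refuted), never below it: a disproof of
the core for some `η < 1` needs arithmetic beyond identities on `ℙ¹` and `𝔾_m` (and would refute `ABC`,
which gives the core for every `η < 8/13`).

Census behind the docstring (cycle 4, `Cruxes/TowerFourSubLiouville/Disproof.lean`, § Cycle 4): the MINIMAL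
torus identity — all five of `w, Z, v, Y, a` of width `1`, i.e. a degree-10 Belyi map with passport
`[4,4,1,1]³` whose two 4-fold poles are conjugate over a real quadratic field — does not exist over `ℚ`:
the passport carries 16 dessins (monodromy `A₆ ×1`, order-720 `×6`, `A₁₀ ×3`, imprimitive order-320 `×6`);
the only Galois-invariant one (`A₆ ≅ PSL₂(9)`, coefficients in `ℚ(√−3)` after normalisation) has the
fixed-point-free antiholomorphic symmetry `r ↦ −2/r̄`, i.e. its unique real form is the pointless conic,
and the other 15 fall into Galois orbits of sizes `2, 4, 3, 2, 2, 2`.  Whether a torus identity of width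
`2` (degree-20 passport `[4⁴,1⁴]² [8²,1⁴]`) exists over `ℚ` is open.
-/

-- `Summit.ABC.ABC` is the mandated summit-side namespace (CONVENTIONS §2); the duplicate is deliberate.
set_option linter.dupNamespace false

namespace Summit.ABC.ABC.Theorems.TowerFourSubLiouville.Negative

open Polynomial UniqueFactorizationMonoid UniqueFactorizationDomain

variable {k : Type*} [Field k] [DecidableEq k]

/-- Degree of the radical of `X^j · A`: at most `1 + deg A` (the root `0` is counted once). -/
theorem natDegree_radical_X_pow_mul_le {A : k[X]} (hA : A ≠ 0) (j : ℕ) :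
    (radical (X ^ j * A)).natDegree ≤ 1 + A.natDegree := by
  have h1 : radical (X ^ j * A) ∣ X * A := by
    calc radical (X ^ j * A) ∣ radical (X ^ j) * radical A := radical_mul_dvd
      _ ∣ X * A := mul_dvd_mul (radical_pow_dvd.trans radical_dvd_self) radical_dvd_self
  calc (radical (X ^ j * A)).natDegree ≤ (X * A).natDegree :=
        natDegree_le_of_dvd h1 (mul_ne_zero X_ne_zero hA)
    _ = 1 + A.natDegree := by rw [natDegree_mul X_ne_zero hA, natDegree_X]

/-- **Mason–Stothers for binomial quartic identities on the torus (the two raw inequalities).**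
In characteristic `0`, `W P⁴ − V Q⁴ = X^j · A` with `V, W, A, Q ≠ 0`, `P` non-constant and
`gcd(WP⁴, VQ⁴) = 1` forces `3 deg P ≤ deg V + deg Q + deg A` and `3 deg Q ≤ deg W + deg P + deg A`
(for `j = 0` this is one less than `masonStothers_enemy_ineq`; the point is that it does not degrade with `j`). -/
theorem masonStothers_torus_ineq [CharZero k] {V W A P Q : k[X]} {j : ℕ} (hV : V ≠ 0) (hW : W ≠ 0)
    (hA : A ≠ 0) (hQ : Q ≠ 0) (hP : 0 < P.natDegree) (hcop : IsCoprime (W * P ^ 4) (V * Q ^ 4))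
    (hid : W * P ^ 4 - V * Q ^ 4 = X ^ j * A) :
    3 * P.natDegree ≤ V.natDegree + Q.natDegree + A.natDegree ∧
      3 * Q.natDegree ≤ W.natDegree + P.natDegree + A.natDegree := by
  have hP0 : P ≠ 0 := by rintro rfl; simp at hP
  -- degree of the radical of `w Z⁴`: at most `deg w + deg Z` (as in `Negative.PolynomialEnemyFloor`)
  have hr4 : ∀ {w Z : k[X]}, w ≠ 0 → Z ≠ 0 →
      (radical (w * Z ^ 4)).natDegree ≤ w.natDegree + Z.natDegree := by
    intro w Z hw hZ
    have h1 : radical (w * Z ^ 4) ∣ w * Z := by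
      calc radical (w * Z ^ 4) ∣ radical w * radical (Z ^ 4) := radical_mul_dvd
        _ ∣ w * Z := mul_dvd_mul radical_dvd_self (radical_pow_dvd.trans radical_dvd_self)
    calc (radical (w * Z ^ 4)).natDegree ≤ (w * Z).natDegree :=
          natDegree_le_of_dvd h1 (mul_ne_zero hw hZ)
      _ = w.natDegree + Z.natDegree := natDegree_mul hw hZ
  set B₁ : k[X] := W * P ^ 4 with hB₁
  set B₂ : k[X] := -(V * Q ^ 4) with hB₂
  set B₃ : k[X] := -(X ^ j * A) with hB₃
  have h10 : B₁ ≠ 0 := mul_ne_zero hW (pow_ne_zero 4 hP0)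
  have h20 : B₂ ≠ 0 := neg_ne_zero.mpr (mul_ne_zero hV (pow_ne_zero 4 hQ))
  have h30 : B₃ ≠ 0 := neg_ne_zero.mpr (mul_ne_zero (pow_ne_zero j X_ne_zero) hA)
  have h12 : IsCoprime B₁ B₂ := hcop.neg_right
  have hsum : B₁ + B₂ + B₃ = 0 := by rw [hB₁, hB₂, hB₃, ← hid]; ring
  have hdeg1 : B₁.natDegree = W.natDegree + 4 * P.natDegree := by
    rw [hB₁, natDegree_mul hW (pow_ne_zero 4 hP0), natDegree_pow]
  have hdeg2 : B₂.natDegree = V.natDegree + 4 * Q.natDegree := by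
    rw [hB₂, natDegree_neg, natDegree_mul hV (pow_ne_zero 4 hQ), natDegree_pow]
  -- the radical of `B₁ B₂ B₃` has degree at most `deg W + deg P + deg V + deg Q + 1 + deg A`
  have hrad : (radical (B₁ * B₂ * B₃)).natDegree ≤
      (W.natDegree + P.natDegree) + (V.natDegree + Q.natDegree) + (1 + A.natDegree) := by
    have hdvd : radical (B₁ * B₂ * B₃) ∣ radical B₁ * radical B₂ * radical B₃ :=
      radical_mul_dvd.trans (mul_dvd_mul_right radical_mul_dvd _)
    have hr1 : (radical B₁).natDegree ≤ W.natDegree + P.natDegree := by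
      rw [hB₁]; exact hr4 hW hP0
    have hr2 : (radical B₂).natDegree ≤ V.natDegree + Q.natDegree := by
      rw [hB₂, radical_neg]; exact hr4 hV hQ
    have hr3 : (radical B₃).natDegree ≤ 1 + A.natDegree := by
      rw [hB₃, radical_neg]; exact natDegree_radical_X_pow_mul_le hA j
    have hne : radical B₁ * radical B₂ * radical B₃ ≠ 0 :=
      mul_ne_zero (mul_ne_zero radical_ne_zero radical_ne_zero) radical_ne_zero
    calc (radical (B₁ * B₂ * B₃)).natDegree ≤ (radical B₁ * radical B₂ * radical B₃).natDegree :=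
          natDegree_le_of_dvd hdvd hne
      _ ≤ (radical B₁ * radical B₂).natDegree + (radical B₃).natDegree := natDegree_mul_le
      _ ≤ (radical B₁).natDegree + (radical B₂).natDegree + (radical B₃).natDegree :=
          Nat.add_le_add_right natDegree_mul_le _
      _ ≤ _ := by omega
  rcases Polynomial.abc h10 h20 h30 h12 hsum with ⟨h1, h2, -⟩ | ⟨hd1, -, -⟩
  · rw [hdeg1] at h1
    rw [hdeg2] at h2
    constructor <;> omega
  · -- degenerate case of Mason–Stothers: `B₁' = 0`, i.e. `B₁` constant — impossible, `deg B₁ ≥ 4`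
    have : B₁.natDegree = 0 := derivative_eq_zero.mp hd1
    omega

/-- **The floor for torus (Pell-boosted) enemies.**  In characteristic `0`, an identity
`W P⁴ − V Q⁴ = X^j · A` (`V, W, A, Q ≠ 0`, `P` non-constant, `gcd(WP⁴, VQ⁴) = 1`) has
`min (deg P) (deg Q) ≤ max (max (deg V) (deg W)) (deg A)`.  In widths on the norm-one torus (all degrees are
doubled widths) this reads `z ≤ max(m, d)`, i.e. `max(θ, φ) ≥ 1`: a Pell-boosted family refutes the uniform
binomial quartic saving `UBQ η` at best for `η > 1`, never for any `η ≤ 1` — compare `deg Z + 1 ≤ max …`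
(`η > 1 + 1/deg Z`) for honest polynomial families (`masonStothers_enemy_floor`). -/
theorem masonStothers_torus_floor [CharZero k] {V W A P Q : k[X]} {j : ℕ} (hV : V ≠ 0) (hW : W ≠ 0)
    (hA : A ≠ 0) (hQ : Q ≠ 0) (hP : 0 < P.natDegree) (hcop : IsCoprime (W * P ^ 4) (V * Q ^ 4))
    (hid : W * P ^ 4 - V * Q ^ 4 = X ^ j * A) :
    min P.natDegree Q.natDegree ≤ max (max V.natDegree W.natDegree) A.natDegree := by
  obtain ⟨h1, h2⟩ := masonStothers_torus_ineq hV hW hA hQ hP hcop hid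
  have hVle : V.natDegree ≤ max (max V.natDegree W.natDegree) A.natDegree :=
    le_trans (le_max_left _ _) (le_max_left _ _)
  have hWle : W.natDegree ≤ max (max V.natDegree W.natDegree) A.natDegree :=
    le_trans (le_max_right _ _) (le_max_left _ _)
  have hAle : A.natDegree ≤ max (max V.natDegree W.natDegree) A.natDegree := le_max_right _ _
  rcases le_total P.natDegree Q.natDegree with hPQ | hQP
  · rw [min_eq_left hPQ]; omega
  · rw [min_eq_right hQP]; omega

/-- The symmetric case `deg P = deg Q` (the shape of every Galois-symmetric torus family, where `Y` and `Z`
have the same width): `deg P ≤ max (max (deg V) (deg W)) (deg A)`. -/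
theorem masonStothers_torus_floor_of_eq [CharZero k] {V W A P Q : k[X]} {j : ℕ} (hV : V ≠ 0) (hW : W ≠ 0)
    (hA : A ≠ 0) (hQ : Q ≠ 0) (hP : 0 < P.natDegree) (hPQ : P.natDegree = Q.natDegree)
    (hcop : IsCoprime (W * P ^ 4) (V * Q ^ 4)) (hid : W * P ^ 4 - V * Q ^ 4 = X ^ j * A) :
    P.natDegree ≤ max (max V.natDegree W.natDegree) A.natDegree := by
  have h := masonStothers_torus_floor hV hW hA hQ hP hcop hid
  rwa [← hPQ, min_self] at h

end Summit.ABC.ABC.Theorems.TowerFourSubLiouville.Negative
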